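import Summits.RiemannHypothesis.RiemannHypothesis.Theses.IntegerScrew
import HarnessLib

/-!
# LINE (rh-idea-2 g5 · W-04 row 2 · lens = finite) — «K1 DECIDED IN KERNEL — FINITE-STATE SPILL BUDGET»

Crux served: item `stmt-RiemannHypothesis-25784` = `IntegerScrew.TwoPrimeFoldRigidity` (L62 K1: «no nonempty locally
finite positive configuration in `0 < Re κ < 1/2`, `Im κ > 1`, summable `m/γ²`, has BOTH prime folds
`k ↦ Σ 4m Re[(cosh(κ k log p) − 1)/κ²]`, `p = 2, 3`, bounded»).  This line REFUTES it as typed: the local target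
`TwoPrimeFoldRigidityFalse := ¬ TwoPrimeFoldRigidity` is derived (kernel-checked composition below) from five stubs —

* `stub_cubedGonInvisible`  [E, M]  exact invisibility of one cubed product-gon level below its orders (rh-idea-3 g3
  OPEN-BAND-MEMO v2 §1b, `CubedGonInvisible` verbatim): finite trigonometric algebra (triple zeros of `D_n³ D'_m³` kill
  the `1/κ²` tilt);
* `stub_spillBudget`        [B, S–M, THE FINITE CERTIFICATE]  a finite list of closed-form real inequalities in
  `sin`, `exp`, `log 3 / log 2 ∈ [1.5849, 1.5850]` (NO irrationality measure): the first-cross spill factors of the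
  five phase types of the merged time sequence `ℕ log 2 ∪ ℕ log 3` (joint J, dense-separated D0/D1/D2, sparse-separated
  S; joint threshold `δ* = 0.45 log 2`, depth `c = 3/10`, orders `≥ 20`) and the weighted-ℓ¹ closure with weights
  `(J, D0, D2, S, D1) = (1, 1, 1, 4, 3)` at ratio `θ = 17/20` (design-grade sup of the true column sums: 0.7227);
* `stub_causalBudget`       [N, S–M]  the abstract Neumann lemma: a causal non-negative recursion whose weighted column
  sums are `≤ θ·weight`, `θ < 1`, with summable seed has summable solution;
* `stub_towerOfBudget`      [T, L–XL by bookkeeping, HARDEST]  THE REDUCTION («theorem first»): E + B + N ⇒ a nonempty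
  locally finite positive configuration in `0 < Re κ < 1/4`, `Im κ > 1`, summable `m/γ²`, whose growing part
  `Σ 2m Re[e^{κt}/κ²]` vanishes at every `t ∈ ℕ⁺ log 2 ∪ ℕ⁺ log 3` (the two-lattice cubed product-gon tower with joint
  steps: separated level at own time `t*` has mass `≤ |R̂(t*)|·e^{1/c}·Λ³/2`, `Λ = m/|D_m(t*)| ≤ 2.9`, spill
  profile `V(t) = (|D_own(t)|/|D_own(t*)|)³ (|D_oth(t)|/|D_oth(t*)|)³ e^{−(t−t*)/(c t*)}`; joint pair `(d, s)`,
  `|d − s| < δ*`, solved as a 2×2 system of conditioning `≤ √2` by the base-height choice; heights are free, so local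
  finiteness costs nothing; every first-cross chain has length `≤ 3` because `{log 3/log 2} = 0.585`);
* `stub_foldsBoundedOfBlind` [F, M]  growing part zero on both lattices + summable `m/γ²` ⇒ both K1 folds bounded
  (`4m Re[(cosh κt − 1)/κ²] = 2m Re[e^{κt}/κ²] + 2m Re[e^{−κt}/κ²] − 4m Re[1/κ²]`, the last two `≤ 6 Σ m/γ²`).

RH is NOT proved; nothing here mentions ζ.  A proof of every stub would put `¬ TwoPrimeFoldRigidity` in kernel: the
L62 record closes as «K1 false as typed — two prime lattices ARE jointly blind to a locally finite positive tower»
(label (s)/(b): a blindness construction; toward RH: 0).  Nothing here bears on the truth of RH.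
-/

noncomputable section

namespace Summit.RiemannHypothesis.RiemannHypothesis.Cruxes.TwoPrimeFold.FiniteSpillBudget

open scoped BigOperators

/-! ### §0 The local target (negation of the served crux, stated as a local def so the skeleton checker can match it) -/

/-- LOCAL TARGET: L62 K1 (`IntegerScrew.TwoPrimeFoldRigidity`, item stmt-RiemannHypothesis-25784) is FALSE as typed. -/
def TwoPrimeFoldRigidityFalse : Prop :=
  ¬ Summit.RiemannHypothesis.RiemannHypothesis.Theses.IntegerScrew.TwoPrimeFoldRigidity

/-! ### §1 Objects (restated verbatim from rh-idea-3 g3 `Sketch.lean`, namespace `…Sketch.RhIdea3`; credit rh-idea-3) -/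

/-- growing-part kernel `g_t(κ) = Re[e^{κ t}/κ²]` of a unit atom at `κ`. -/
def growKernel (t : ℝ) (κ : ℂ) : ℝ := (Complex.exp (κ * t) / κ ^ 2).re

/-- Coefficient of `x^J` in `(1 + x + ⋯ + x^{n-1})^3` (discrete B-spline of order 3). -/
def bspline3 (n J : ℕ) : ℕ :=
  (((Finset.range n) ×ˢ (Finset.range n)) ×ˢ (Finset.range n)).filter (fun p => p.1.1 + p.1.2 + p.2 = J) |>.card

/-- Growing-part contribution at time `t` of ONE cubed product-gon level: orders `(n, m)`, steps `(h, h')`, abscissa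
`σ`, base ordinate `γ₀`, scale `c`; ordinates `γ₀ + 2πJ/(nh) + 2πL/(mh')`, weights `c·b_n(J)·b_m(L)·‖κ‖⁴`. -/
def levelSum (n m : ℕ) (h h' σ γ₀ c t : ℝ) : ℝ :=
  ∑ J ∈ Finset.range (3 * n - 2), ∑ L ∈ Finset.range (3 * m - 2),
    2 * (c * (bspline3 n J : ℝ) * (bspline3 m L : ℝ) *
      ‖((σ : ℂ) + (γ₀ + 2 * Real.pi * J / (n * h) + 2 * Real.pi * L / (m * h')) * Complex.I)‖ ^ 4) *
      growKernel t ((σ : ℂ) + (γ₀ + 2 * Real.pi * J / (n * h) + 2 * Real.pi * L / (m * h')) * Complex.I)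

/-- [E] Exact invisibility of a cubed product-gon level below its orders, tilt included (rh-idea-3 §1b, [R], M). -/
def CubedGonInvisible : Prop :=
  ∀ (n m : ℕ) (h h' σ γ₀ c : ℝ), 0 < n → 0 < m → 0 < h → 0 < h' →
    (∀ k : ℕ, ¬ n ∣ k → levelSum n m h h' σ γ₀ c (k * h) = 0) ∧
    (∀ l : ℕ, ¬ m ∣ l → levelSum n m h h' σ γ₀ c (l * h') = 0)

/-! ### §2 The finite certificate [B] — closed-form inequalities, no irrationality measure -/

/-- the period ratio `H = log 3 / log 2` (sparse step in units of the dense step). -/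
def H23 : ℝ := Real.log 3 / Real.log 2

/-- asymptotic first-cross factor of a DENSE-separated level into the next sparse time at phase distance `δ` (units of
`log 2`): `ρ_D(δ) = [ |sin πδ| / (H |sin(πδ/H)|) ]³ = [sinc(δ)/sinc(δ/H)]³`. -/
def rhoD (δ : ℝ) : ℝ := (|Real.sin (Real.pi * δ)| / (H23 * |Real.sin (Real.pi * δ / H23)|)) ^ 3

/-- asymptotic first-cross factor of a SPARSE-separated level into the next dense time: `ρ_S(δ) = ρ_D(δ)⁻¹`. -/
def rhoS (δ : ℝ) : ℝ := (H23 * |Real.sin (Real.pi * δ / H23)| / |Real.sin (Real.pi * δ)|) ^ 3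

/-- [B] THE FINITE CERTIFICATE (S–M, mechanical): (i) a 4-digit enclosure of `log 3/log 2`; (ii)–(v) the suprema of the
first-cross factors over the phase interval of each separated type (D0: target joint, `δ₊ ∈ [0.55, 1.135]`; D1: target
sparse-separated, `δ₊ ∈ [0.45, 0.55]`; S: target dense (type D2), `δ₊ ∈ [0.45, 0.55]`; D2: `δ₊ ∈ [H − 0.55, H − 0.45]
⊂ [1.03, 1.135]`); (vi) long-range decay per own multiple at depth `c = 3/10`; (vii) the finite-order correction at
`K₀ = 20`; (viii) weighted-ℓ¹ closure, weights `(J, D0, D2, S, D1) = (1, 1, 1, 4, 3)`, long-range allowances `0.06` per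
unit residual for separated and `0.16` for joint sources (to be DERIVED in stub T from (vi) and `|sin jy| ≤ j|sin y|`,
`sin x ≥ 2x/π`; design-grade true values 0.0172 / 0.1046), ratio `θ = 17/20`.  Design-grade values (budget.py,
attached): sup ρ on the four intervals = 0.347 / 0.511 / 2.88 / 0.037; true weighted column-sum sup 0.7227 < 1.
If the prover of T needs further elementary inequalities of the same closed-form kind they are appended here. -/
def SpillBudget : Prop :=
  ((1.5849 : ℝ) ≤ H23 ∧ H23 ≤ 1.5850) ∧
  (∀ δ : ℝ, 0.55 ≤ δ → δ ≤ 1.135 → rhoD δ ≤ 0.36) ∧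
  (∀ δ : ℝ, 0.45 ≤ δ → δ ≤ 0.55 → rhoD δ ≤ 0.53) ∧
  (∀ δ : ℝ, 0.45 ≤ δ → δ ≤ 0.55 → rhoS δ ≤ 2.95) ∧
  (∀ δ : ℝ, 1.03 ≤ δ → δ ≤ 1.135 → rhoD δ ≤ 0.041) ∧
  (Real.exp (-(10 / 3 : ℝ)) ≤ 0.036) ∧
  ((Real.pi * 1.135 / 20) ^ 2 ≤ (0.032 : ℝ)) ∧
  ((2.95 : ℝ) * 1 + 0.06 * 4 ≤ (17 / 20) * 4 ∧ (0.53 : ℝ) * 4 + 0.06 * 4 ≤ (17 / 20) * 3 ∧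
    (0.36 : ℝ) * 1 + 0.06 * 4 ≤ (17 / 20) * 1 ∧ (0.041 : ℝ) * 1 + 0.06 * 4 ≤ (17 / 20) * 1 ∧ (0.16 : ℝ) * 4 ≤ (17 / 20) * 1)

/-! ### §3 The abstract Neumann lemma [N] and the K1-ready blind configuration -/

/-- [N] causal non-negative recursion with weighted column sums `≤ θ·w`, `θ < 1`, summable weighted seed ⇒ summable
weighted solution with the geometric-series bound (S–M: Tonelli on a non-negative double series + monotone limits). -/
def CausalBudget : Prop :=
  ∀ (X s w : ℕ → ℝ) (a : ℕ → ℕ → ℝ) (θ : ℝ), 0 ≤ θ → θ < 1 →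
    (∀ j, 0 ≤ X j ∧ 0 ≤ s j ∧ 1 ≤ w j) → (∀ i j, 0 ≤ a i j) →
    (∀ j, X j ≤ s j + ∑ i ∈ Finset.range j, a i j * X i) →
    (∀ i, Summable (fun j => w j * a i j) ∧ ∑' j, w j * a i j ≤ θ * w i) →
    Summable (fun j => w j * s j) →
    Summable (fun j => w j * X j) ∧ ∑' j, w j * X j ≤ (∑' j, w j * s j) / (1 - θ)

/-- a NONEMPTY locally finite positive configuration in `0 < Re κ < A`, `Im κ > 1`, summable `m/(Im κ)²`, whose growing
part vanishes (as a convergent series) at every `t = k h` and `t = k h'`, `k ≥ 1`. -/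
def TwoLatticeBlindConfig (h h' A : ℝ) : Prop :=
  ∃ (ι : Type) (m : ι → ℝ) (κ : ι → ℂ), Nonempty ι ∧ (∀ i, 0 < m i) ∧ (∀ i, 0 < (κ i).re ∧ (κ i).re < A) ∧
    (∀ i, 1 < (κ i).im) ∧ (∀ T : ℝ, {i | (κ i).im ≤ T}.Finite) ∧ Summable (fun i ↦ m i / (κ i).im ^ 2) ∧
    ∀ k : ℕ, 1 ≤ k →
      HasSum (fun i ↦ 2 * m i * growKernel ((k : ℝ) * h) (κ i)) 0 ∧
      HasSum (fun i ↦ 2 * m i * growKernel ((k : ℝ) * h') (κ i)) 0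

/-- [T] THE REDUCTION (theorem first; L–XL by bookkeeping, hardest stub): exact level invisibility + the finite spill
certificate + the Neumann lemma ⇒ the two-lattice cubed product-gon tower on `(log 2, log 3)` converges to a blind,
locally finite, positive, summable-`m/γ²` configuration in `0 < Re κ < 1/4`, `Im κ > 1`. -/
def TowerOfBudget : Prop :=
  CubedGonInvisible → SpillBudget → CausalBudget → TwoLatticeBlindConfig (Real.log 2) (Real.log 3) (1 / 4)

/-- [F] both prime folds of a blind configuration are bounded (M): growing part `= 0` on both lattices, and the
non-growing parts `2m Re[e^{−κt}/κ²] − 4m Re[1/κ²]` are absolutely bounded by `6 Σ m/γ²` uniformly in `k`. -/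
def FoldsBoundedOfBlind : Prop :=
  ∀ (h h' A : ℝ), 0 < h → 0 < h' → A ≤ 1 / 2 → TwoLatticeBlindConfig h h' A →
    ∃ (ι : Type) (m : ι → ℝ) (κ : ι → ℂ), Nonempty ι ∧ (∀ i, 0 < m i) ∧ (∀ i, 0 < (κ i).re ∧ (κ i).re < 1 / 2) ∧
      (∀ i, 1 < (κ i).im) ∧ (∀ T : ℝ, {i | (κ i).im ≤ T}.Finite) ∧ Summable (fun i ↦ m i / (κ i).im ^ 2) ∧
      (∃ A : ℝ, ∀ k : ℕ, 1 ≤ k →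
        |∑' i, 4 * m i * ((Complex.cosh (κ i * (((k : ℝ) * h : ℝ) : ℂ)) - 1) / κ i ^ 2).re| ≤ A) ∧
      (∃ A : ℝ, ∀ k : ℕ, 1 ≤ k →
        |∑' i, 4 * m i * ((Complex.cosh (κ i * (((k : ℝ) * h' : ℝ) : ℂ)) - 1) / κ i ^ 2).re| ≤ A)

/-! ### §4 Registered stubs (sorry ONLY here) -/

/-- stub E (M): finite trigonometric algebra; credit rh-idea-3 g3 §1b. -/
theorem stub_cubedGonInvisible : CubedGonInvisible := by
  sorry

/-- stub B (S–M, the finite certificate; «computation second»): interval bounds for `sin`, `exp`, `log`. -/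
theorem stub_spillBudget : SpillBudget := by
  sorry

/-- stub N (S–M): the abstract Neumann / geometric-series lemma for causal non-negative recursions. -/
theorem stub_causalBudget : CausalBudget := by
  sorry

/-- stub T (L–XL, hardest): the reduction of the two-lattice tower to E + B + N. -/
theorem stub_towerOfBudget : TowerOfBudget := by
  sorry

/-- stub F (M): bounded folds from two-lattice blindness. -/
theorem stub_foldsBoundedOfBlind : FoldsBoundedOfBlind := by
  sorry

/-! ### §5 Kernel-checked composition (no sorry below this line) -/

/-- COMPOSITION: the five stubs refute L62 K1 as typed. -/
theorem TwoPrimeFoldRigidityFalse_of : TwoPrimeFoldRigidityFalse := by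
  intro hK1
  have hcfg : TwoLatticeBlindConfig (Real.log 2) (Real.log 3) (1 / 4) :=
    stub_towerOfBudget stub_cubedGonInvisible stub_spillBudget stub_causalBudget
  have h2 : (0 : ℝ) < Real.log 2 := Real.log_pos (by norm_num)
  have h3 : (0 : ℝ) < Real.log 3 := Real.log_pos (by norm_num)
  obtain ⟨ι, m, κ, hne, hm, hre, him, hfin, hsum, hA2, hA3⟩ :=
    stub_foldsBoundedOfBlind (Real.log 2) (Real.log 3) (1 / 4) h2 h3 (by norm_num) hcfg
  exact (hK1 ι m κ hm hre him hfin hsum hA2 hA3).false hne.some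

/-- the same composition with the stubs as explicit hypotheses (for readers and BC-style probes). -/
theorem TwoPrimeFoldRigidityFalse_of' (hE : CubedGonInvisible) (hB : SpillBudget) (hN : CausalBudget)
    (hT : TowerOfBudget) (hF : FoldsBoundedOfBlind) : TwoPrimeFoldRigidityFalse := by
  intro hK1
  have h2 : (0 : ℝ) < Real.log 2 := Real.log_pos (by norm_num)
  have h3 : (0 : ℝ) < Real.log 3 := Real.log_pos (by norm_num)
  obtain ⟨ι, m, κ, hne, hm, hre, him, hfin, hsum, hA2, hA3⟩ :=
    hF (Real.log 2) (Real.log 3) (1 / 4) h2 h3 (by norm_num) (hT hE hB hN)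
  exact (hK1 ι m κ hm hre him hfin hsum hA2 hA3).false hne.some

end Summit.RiemannHypothesis.RiemannHypothesis.Cruxes.TwoPrimeFold.FiniteSpillBudget

end
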